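import Summits.Langlands.Langlands.Theorems.DyadicOddResidueDyadicEisensteinFMStubCmTateTwistNewformGlue
import Summits.Langlands.Langlands.Theorems.DyadicOddResidueOddPrimesRegularFM
import Literature.NumberTheory.GaloisRepresentations.DeRhamLAdicCharacterHecke
import Literature.NumberTheory.PAdicHodge.DeRhamInducedRepresentation
import Literature.NumberTheory.EllipticCurves.CMNewformOfHeckeCharacter
import Literature.NumberTheory.GaloisRepresentations.WeilLAdicCharacterProofs
import Literature.NumberTheory.GaloisRepresentations.WeakAbelianDirectSummandCyclotomicProofs
import Literature.NumberTheory.GaloisRepresentations.FrobeniusDensityOneProofs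
import Literature.NumberTheory.GaloisRepresentations.WeakAbelianDirectSummand
import Literature.NumberTheory.GaloisRepresentations.AlgebraicHeckeCharacterPurity
import Literature.NumberTheory.Automorphic.ReciprocityGLnDescentProofs
import Literature.NumberTheory.Automorphic.AshSmithTheoryHeckeProofs
import Literature.NumberTheory.EllipticCurves.NewformGaloisRepPadicAlgClProofs
import Literature.FieldTheory.Galois.SolvableCompositum
import Literature.FieldTheory.AlgClosed.PadicAlgClEquivComplex
import HarnessLib

/-!
# Stub A′ `stub_cmTateTwistNewform` of the crux `DyadicOddResidue.DyadicEisensteinFM` (stmt-Langlands-18741):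
# the CM leg of Fontaine–Mazur for `GL₂/ℚ` at `ℓ = 2`, CLOSED MODULO NAMED PRINTED FACTS

Line `ordinary-seed-propagation`, stub A′ (rev L2; it implies stub A by the landed
`inducedCase_of_tateTwistNewform`):

> `ρ : Γ_ℚ → GL₂(ℚ̄₂)` irreducible, unramified a.e., de Rham at `2` (Fontaine's pinned datum) with
> multiplicity-free labelled Hodge–Tate weights, reducible on `Γ_K` for a quadratic number field `K`
> ⟹ some Tate twist `ρ ⊗ ε₂^m` is attached away from `2N` to a newform `f ∈ S_k(Γ₁(N))`.

This file proves `cmTateTwistNewform_of_facts : F2′ → F2 → H → F3 → G → <A′ verbatim>` where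

* F2′ `isDeRhamFramed_of_isDeRhamFramed_induce` (fact filed by this line; Patrikis 2019, Lemma 7.2.1 with
  Mackey: de Rham-ness descends from `Ind_K^ℚ θ` to `θ`),
* F2 `FramedGaloisRep.exists_heckeCharacter_of_isDeRhamFramed` (LANDED fact, p164564; Serre 1968
  Ch. III / Patrikis Prop. 2.2.1: a de Rham `ℓ`-adic character is an algebraic Hecke character),
* H `labelledHodgeTateWeightsAt_induce_of_parallel` (fact filed by this line; Patrikis 2019, Cor. 2.2.3 (proof),
  Lemma 2.2.4, Lemma 7.2.1: an induced Hecke character with PARALLEL exponents has parallel labelled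
  Hodge–Tate weights — this makes the real-quadratic and the "equal exponents" sub-cases contradict
  the multiplicity-free hypothesis),
* F3 `Ribet1977_cmNewform_of_heckeCharacter` (fact filed by this line; Hecke–Shimura–Ribet: the CM newform of
  a Hecke character of an imaginary quadratic field of infinity type `σ^{k-1}`, `k ≥ 2`, Ribet 1977
  Thm. (3.4), Cor. (3.5) and Remark (3.5)),
* G — a GLUE hypothesis spelled out in the signature (tree bookkeeping, NOT a literature fact: the
  twist `ψ = χ⁻¹‖·‖^{-m}` normalising an algebraic Hecke character with distinct exponents to Ribet's
  infinity type; provable from the tree's Hecke-character API, left open here),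

and everything else is kernel-checked glue: Clifford (landed `exists_character_charpoly_eq_induce`),
Brauer–Nesbitt (`exists_conj_of_charpoly_eq_of_isIrreducible`), Weil's `ℓ`-adic character
(`HeckeCharacter.IsAlgebraic.exists_lAdic`) and rank-one rigidity
(`FramedGaloisRep.eq_of_frobenius_eq_of_hasDirichletDensity_one`), purity of algebraic Hecke
characters (`HasInfinityType.exists_two_mul_add_eq_weight_mul_mult`), Frobenius polynomials of induced
representations (`FramedGaloisRep.hasFrobCharpolyAt_induce`, `isUnramifiedAt_induce`) and their Tate
twists (`scaleRoots_inducedFrobPolynomial`).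
-/

set_option linter.dupNamespace false -- project-wide option; `Summit.Langlands.Langlands` is the mandated namespace

noncomputable section

open scoped MatrixGroups Matrix Classical Polynomial NumberField ModularForm
open NumberField IsDedekindDomain Filter Field Polynomial CongruenceSubgroup
open Literature.NumberTheory.Automorphic Literature.NumberTheory.GaloisRepresentations
open Literature.NumberTheory.EllipticCurves.ModularForms Literature.NumberTheory.PAdicHodge

/-! ## 1. The named printed facts

F2′ = `Literature.NumberTheory.PAdicHodge.isDeRhamFramed_of_isDeRhamFramed_induce`,
H = `Literature.NumberTheory.PAdicHodge.labelledHodgeTateWeightsAt_induce_of_parallel`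
(`Literature/NumberTheory/PAdicHodge/DeRhamInducedRepresentation.lean`),
F3 = `Literature.NumberTheory.EllipticCurves.ModularForms.Ribet1977_cmNewform_of_heckeCharacter`
(`Literature/NumberTheory/EllipticCurves/CMNewformOfHeckeCharacter.lean`),
F2 = `FramedGaloisRep.exists_heckeCharacter_of_isDeRhamFramed`
(`Literature/NumberTheory/GaloisRepresentations/DeRhamLAdicCharacterHecke.lean`) — all filed by this line. -/

namespace Summit.Langlands.Langlands.Theorems.DyadicEisensteinFM

/-! ## 2. Glue lemmas -/

section Glue

variable {K : Type} [Field K] [NumberField K] {ℓ : ℕ} [Fact ℓ.Prime]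

/-- A place `v ∣ ℓ` of `ℚ` together with a continuous label `ℚ_v → ℚ̄_ℓ` exists (the place and the
completion embedding cut out by `ℚ → ℚ̄_ℓ`). [folklore] -/
theorem exists_place_continuous_label (ℓ : ℕ) [Fact ℓ.Prime] :
    ∃ (v : HeightOneSpectrum (𝓞 ℚ)) (_ : ((ℓ : ℕ) : 𝓞 ℚ) ∈ v.asIdeal)
      (τ : v.adicCompletion ℚ →+* PadicAlgCl ℓ), Continuous τ := by
  obtain ⟨v, hv, hjv⟩ :=
    Literature.NumberTheory.EllipticCurves.exists_heightOneSpectrum_of_ringHom_padicAlgCl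
      (algebraMap ℚ (PadicAlgCl ℓ))
  obtain ⟨τ, hτ, -⟩ :=
    Literature.NumberTheory.EllipticCurves.exists_continuous_ringHom_adicCompletion_padicAlgCl
      (algebraMap ℚ (PadicAlgCl ℓ)) v hv hjv
  exact ⟨v, hv, τ, hτ⟩

/-- **Rank-one rigidity**: two continuous characters `Γ_K → GL₁(ℚ̄_ℓ)` with the same Frobenius
characteristic polynomial `X - a_v` at all but finitely many `v` are equal (Frobenius density one,
`FramedGaloisRep.eq_of_frobenius_eq_of_hasDirichletDensity_one`). [folklore] -/
theorem eq_of_eventually_hasFrobCharpolyAt_eq (θ r : FramedGaloisRep K (PadicAlgCl ℓ) 1)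
    (h : ∀ᶠ v : HeightOneSpectrum (𝓞 K) in cofinite, ∃ a : PadicAlgCl ℓ,
      θ.HasFrobCharpolyAt v (X - C a) ∧ r.HasFrobCharpolyAt v (X - C a)) : θ = r := by
  refine FramedGaloisRep.eq_of_frobenius_eq_of_hasDirichletDensity_one θ r
    (hasDirichletDensity_one_of_eventually h) fun v hv 𝔓 h𝔓 Φ hΦ => ?_
  obtain ⟨a, h1, h2⟩ := hv
  have e1 := (FramedGaloisRep.hasFrobCharpolyAt_iff_of_rank_one θ v a).mp h1 𝔓 h𝔓 Φ hΦ
  have e2 := (FramedGaloisRep.hasFrobCharpolyAt_iff_of_rank_one r v a).mp h2 𝔓 h𝔓 Φ hΦ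
  refine Units.ext (Matrix.ext fun i j => ?_)
  rw [Subsingleton.elim i 0, Subsingleton.elim j 0, e1, e2]

/-- **Purity over a totally real field forces equal exponents**: for `K` totally real and a Hecke
character of infinity type `(p, q)`, all embedding exponents `n_φ = p_w + q_w` coincide
(`2 (p_w + q_w) = wt · [K_w : ℝ] = wt`, `HasInfinityType.exists_two_mul_add_eq_weight_mul_mult`).
[cite: Patrikis2019, Lemma 2.1.3 (arXiv:1207.6724 §2.1)] -/
theorem embExponent_eq_of_isTotallyReal [IsTotallyReal K] {χ : HeckeCharacter K}
    {p q : InfinitePlace K → ℤ} (h : χ.HasInfinityType p q) (φ φ' : K →+* ℂ) :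
    HeckeCharacter.embExponent p q φ = HeckeCharacter.embExponent p q φ' := by
  obtain ⟨wt, hwt⟩ := h.exists_two_mul_add_eq_weight_mul_mult
  have key : ∀ ψ : K →+* ℂ, 2 * HeckeCharacter.embExponent p q ψ = wt := by
    intro ψ
    have hreal : ComplexEmbedding.IsReal ψ :=
      (InfinitePlace.isReal_mk_iff).mp (IsTotallyReal.isReal (InfinitePlace.mk ψ))
    have hw : (InfinitePlace.mk ψ).IsReal := IsTotallyReal.isReal _
    rw [HeckeCharacter.embExponent, if_pos hreal, hwt (InfinitePlace.mk ψ), InfinitePlace.mult,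
      if_pos hw, Nat.cast_one, mul_one]
  have := (key φ).trans (key φ').symm
  omega

omit [NumberField K] in
/-- `2 ∉ w` for a place `w` of `K` above a place `v` of `ℚ` with `2 ∉ v` (any natural number).
[folklore] -/
theorem natCast_not_mem_of_under_eq [NumberField K] {v : HeightOneSpectrum (𝓞 ℚ)}
    {w : HeightOneSpectrum (𝓞 K)} (hw : w.asIdeal.under (𝓞 ℚ) = v.asIdeal) {n : ℕ}
    (hv : ((n : ℕ) : 𝓞 ℚ) ∉ v.asIdeal) : ((n : ℕ) : 𝓞 K) ∉ w.asIdeal := by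
  intro h
  apply hv
  rw [← hw, Ideal.under_def, Ideal.mem_comap, map_natCast]
  exact h

end Glue

/-! ## 3. The reduction -/

set_option maxHeartbeats 800000 in
/-- **Stub A′ modulo named printed facts.**  Granting F2′
(`isDeRhamFramed_of_isDeRhamFramed_induce`), F2 (`FramedGaloisRep.exists_heckeCharacter_of_isDeRhamFramed`),
H (`labelledHodgeTateWeightsAt_induce_of_parallel`), F3 (`Ribet1977_cmNewform_of_heckeCharacter`) and the
tree-side normalisation glue G (the fifth hypothesis, spelled out — Theorems-side bookkeeping, provable
from the tree's Hecke-character API and NOT a literature fact: for `K` quadratic not real and `χ` of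
infinity type `(p, q)` with distinct embedding exponents there are `k ≥ 2`, `m ∈ ℤ` and `ψ` of infinity
type `(k-1, 0)` or `(0, k-1)`, unramified exactly where `χ` is, with `ψ(ϖ_w) = χ(ϖ_w)⁻¹ (N w)^m`;
namely `ψ = χ⁻¹‖·‖^{-m}`, `m = min(n_σ, n_σ̄)`, `k = |n_σ - n_σ̄| + 1`), stub A′ holds — verbatim the
registered signature.  Proof: Clifford gives `θ` with `det(X - ρ) = det(X - Ind θ)`; Brauer–Nesbitt conjugates
`ρ` to `Ind θ`, so `Ind θ` is de Rham at `2` with `ρ`'s labelled weights; F2′ and F2 make `θ` the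
`2`-adic avatar of an algebraic Hecke character `χ` of `K` (at ALL good places, by Weil's theorem and
rank-one rigidity); if the two embedding exponents of `χ` agree, H gives parallel weights `{m, m}`,
contradicting multiplicity-freeness (this covers every real quadratic `K`, by purity); otherwise `K` is
imaginary, G normalises `χ` to Ribet's `ψ = χ⁻¹‖·‖^{-m}` and F3 supplies the CM newform `f` whose Hecke
polynomials are the induced Frobenius polynomials of `ψ`, i.e. the Tate twist by `ε₂^m` of those of
`Ind θ ≅ ρ` (`scaleRoots_inducedFrobPolynomial`). [cite: Ribet1977Nebentypus, Thm. (3.4) and Cor. (3.5)]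
[cite: Patrikis2019, Prop. 2.2.1, Lemma 2.2.4, Lemma 7.2.1] -/
theorem cmTateTwistNewform_of_facts : Literature.NumberTheory.PAdicHodge.isDeRhamFramed_of_isDeRhamFramed_induce → Literature.NumberTheory.GaloisRepresentations.FramedGaloisRep.exists_heckeCharacter_of_isDeRhamFramed → Literature.NumberTheory.PAdicHodge.labelledHodgeTateWeightsAt_induce_of_parallel → Literature.NumberTheory.EllipticCurves.ModularForms.Ribet1977_cmNewform_of_heckeCharacter → (∀ (K : Type) [Field K] [NumberField K], Module.finrank ℚ K = 2 → ¬ NumberField.IsTotallyReal K → ∀ (χ : Literature.NumberTheory.GaloisRepresentations.HeckeCharacter K) (p q : NumberField.InfinitePlace K → ℤ), χ.HasInfinityType p q → (∃ φ φ' : K →+* ℂ, Literature.NumberTheory.GaloisRepresentations.HeckeCharacter.embExponent p q φ ≠ Literature.NumberTheory.GaloisRepresentations.HeckeCharacter.embExponent p q φ') → ∃ (k : ℕ) (m : ℤ) (ψ : Literature.NumberTheory.GaloisRepresentations.HeckeCharacter K), 2 ≤ k ∧ (ψ.HasInfinityType (fun _ => (k : ℤ) - 1) (fun _ => 0) ∨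 ψ.HasInfinityType (fun _ => 0) (fun _ => (k : ℤ) - 1)) ∧ (∀ w : IsDedekindDomain.HeightOneSpectrum (NumberField.RingOfIntegers K), ψ.IsUnramifiedAt w ↔ χ.IsUnramifiedAt w) ∧ ∀ w : IsDedekindDomain.HeightOneSpectrum (NumberField.RingOfIntegers K), ψ.valueAtUniformizer w = (χ.valueAtUniformizer w)⁻¹ * (w.residueCard : ℂ) ^ m) → ∀ (ρ : Literature.NumberTheory.GaloisRepresentations.FramedGaloisRep ℚ (PadicAlgCl 2) 2), ρ.toGaloisRep.IsIrreducible → (∀ᶠ v : IsDedekindDomain.HeightOneSpectrum (NumberField.RingOfIntegers ℚ) in Filter.cofinite, ρ.IsUnramifiedAt v) → (∀ (v : IsDedekindDomain.HeightOneSpectrum (NumberField.RingOfIntegers ℚ)) (hv : ((2 : ℕ) : NumberField.RingOfIntegers ℚ) ∈ v.asIdeal), (Literature.NumberTheory.PAdicHodge.fontainePstAdicCompletion v 2 hv).IsDeRhamFramed (ρ.toLocal v) ∧ ∀ τ : v.adicCompletion ℚ →+* PadicAlgCl 2, Continuous τ → (ρ.labelledHodgeTateWeightsAt v (Literature.NumberTheory.PAdicHodge.fontainePstAdicCompletion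 v 2 hv).algebra (Literature.NumberTheory.PAdicHodge.fontainePstAdicCompletion v 2 hv).𝔅 τ).Nodup) → (∃ (K : Type) (_ : Field K) (_ : NumberField K), Module.finrank ℚ K = 2 ∧ ¬ (ρ.restrictField K).toGaloisRep.IsIrreducible) → ∃ (χ : Field.absoluteGaloisGroup ℚ →ₜ* (PadicAlgCl 2)ˣ) (m : ℤ), (∀ σ, χ σ = Literature.NumberTheory.GaloisRepresentations.cyclotomicPadicAlgCl ℚ 2 σ ^ m) ∧ ∃ (N : ℕ) (_ : NeZero N) (k : ℤ) (f : CuspForm (CongruenceSubgroup.Gamma1 N) k) (ιf : Literature.NumberTheory.EllipticCurves.ModularForms.coeffCharField f →+* PadicAlgCl 2), Literature.NumberTheory.EllipticCurves.ModularForms.IsNewform1 f ∧ Literature.NumberTheory.EllipticCurves.ModularForms.IsGaloisRepOfNewform1 f ιf {q | q ∣ N * 2} (Literature.NumberTheory.GaloisRepresentations.FramedRep.twist ρ χ) := by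
  intro hF2' hF2 hH hF3 hG ρ hirr _hunr hdR hK
  obtain ⟨K, _, _, hK2, hred⟩ := hK
  classical
  haveI : IsGalois ℚ K := Literature.FieldTheory.Galois.isGalois_of_finrank_eq_two hK2
  obtain ⟨ι⟩ := PadicAlgCl.nonempty_ringEquiv_complex 2
  -- Clifford and Brauer–Nesbitt
  obtain ⟨θ, hθ⟩ := exists_character_charpoly_eq_induce ρ hirr K hK2 hred
  obtain ⟨P, hP⟩ := exists_conj_of_charpoly_eq_of_isIrreducible ρ (θ.induce ℚ hK2) hirr hθ
  -- `θ` is de Rham above `2` (F2′), hence an algebraic Hecke character `χ` (F2)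
  have hdRθ : ∀ (w : HeightOneSpectrum (𝓞 K)) (hw : ((2 : ℕ) : 𝓞 K) ∈ w.asIdeal),
      (fontainePstAdicCompletion w 2 hw).IsDeRhamFramed (θ.toLocal w) :=
    hF2' K 2 hK2 2 1 θ fun v hv =>
      (isDeRhamFramed_toLocal_iff_of_forall_eq_conj hP v _).mpr (hdR v hv).1
  obtain ⟨χ, hχalg, hχθ⟩ := hF2 K 2 θ hdRθ ι
  obtain ⟨p, q, hpq⟩ := χ.isAlgebraic_iff_exists_hasInfinityType.mp hχalg
  -- Weil's character of `χ` IS `θ` (rank-one rigidity), so the dictionary holds at ALL good places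
  obtain ⟨r, hr⟩ := HeckeCharacter.IsAlgebraic.exists_lAdic hχalg ι
  have hθr : θ = r := by
    refine eq_of_eventually_hasFrobCharpolyAt_eq θ r ?_
    filter_upwards [hχθ, FramedGaloisRep.eventually_natCast_not_mem K 2] with w hw hw2
    exact ⟨_, hw.2.2, (hr w hw2 hw.1).2⟩
  have hθgood : ∀ w : HeightOneSpectrum (𝓞 K), ((2 : ℕ) : 𝓞 K) ∉ w.asIdeal → χ.IsUnramifiedAt w →
      θ.IsUnramifiedAt w ∧ θ.HasFrobCharpolyAt w (X - C (ι.symm (χ.valueAtUniformizer w)⁻¹)) := by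
    rw [hθr]; exact hr
  -- Case 1: parallel exponents — contradiction with multiplicity-freeness (H); covers real `K`
  by_cases hpar : ∀ φ φ' : K →+* ℂ,
      HeckeCharacter.embExponent p q φ = HeckeCharacter.embExponent p q φ'
  · exfalso
    obtain ⟨φ₀⟩ : Nonempty (K →+* ℂ) := ⟨(Classical.arbitrary (InfinitePlace K)).embedding⟩
    obtain ⟨m, hm⟩ := hH K 2 hK2 2 θ ι χ p q hpq (hχθ.mono fun w hw => hw.2.2)
      (HeckeCharacter.embExponent p q φ₀) fun φ => hpar φ φ₀
    obtain ⟨v, hv, τ, hτ⟩ := exists_place_continuous_label 2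
    have hnd := (hdR v hv).2 τ hτ
    rw [← labelledHodgeTateWeightsAt_eq_of_forall_eq_conj hP v _ τ, hm v hv τ hτ] at hnd
    exact absurd hnd (by simp [Multiset.replicate_succ])
  -- Case 2: distinct exponents — `K` is imaginary, Ribet's CM newform
  push Not at hpar
  obtain ⟨φ₁, φ₂, hne⟩ := hpar
  have hKreal : ¬ IsTotallyReal K := fun hKr => hne (embExponent_eq_of_isTotallyReal hpq φ₁ φ₂)
  obtain ⟨k, m, ψ, hk, hψtype, hψunr, hψval⟩ := hG K hK2 hKreal χ p q hpq ⟨φ₁, φ₂, hne⟩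
  obtain ⟨N, hN, f, hnew, hf⟩ := hF3 K hK2 hKreal k hk ψ hψtype
  let ιf : coeffCharField f →+* PadicAlgCl 2 :=
    ι.symm.toRingHom.comp (algebraMap (coeffCharField f) ℂ)
  -- the Tate twist `ε₂^m` as a continuous character
  let χm : absoluteGaloisGroup ℚ →ₜ* (PadicAlgCl 2)ˣ :=
    { toFun := fun σ => cyclotomicPadicAlgCl ℚ 2 σ ^ m
      map_one' := by simp
      map_mul' := fun σ τ => by rw [map_mul, mul_zpow]
      continuous_toFun := (cyclotomicPadicAlgCl ℚ 2).continuous.zpow m }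
  have hχm : ∀ σ, χm σ = cyclotomicPadicAlgCl ℚ 2 σ ^ m := fun σ => rfl
  refine ⟨χm, m, hχm, N, hN, (k : ℤ), f, ιf, hnew, ?_⟩
  intro v hvS
  set pv : ℕ := ((Rat.HeightOneSpectrum.primesEquiv v : Nat.Primes) : ℕ) with hpv
  have hpN : ¬ pv ∣ N := fun h => hvS (dvd_mul_of_dvd_left h 2)
  have hp2 : pv ≠ 2 := fun h => hvS (h ▸ dvd_mul_left 2 N)
  have hv2 : ((2 : ℕ) : 𝓞 ℚ) ∉ v.asIdeal := by
    rw [Rat.natCast_mem_asIdeal_iff]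
    intro h
    exact hp2 ((Nat.prime_dvd_prime_iff_eq (Rat.HeightOneSpectrum.primesEquiv v).2 Nat.prime_two).mp h)
  obtain ⟨he, hψv, hpoly⟩ := hf v hpN
  have hI : ∀ 𝔓 ∈ v.primesAbove,
      𝔓.inertia (absoluteGaloisGroup ℚ) ≤ (absGaloisRestrict ℚ K).range :=
    fun 𝔓 h𝔓 => inertia_le_range_absGaloisRestrict ℚ K he h𝔓
  have hgoodv : ∀ w : HeightOneSpectrum (𝓞 K), w.asIdeal.under (𝓞 ℚ) = v.asIdeal →
      θ.IsUnramifiedAt w ∧ θ.HasFrobCharpolyAt w (X - C (ι.symm (χ.valueAtUniformizer w)⁻¹)) :=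
    fun w hw => hθgood w (natCast_not_mem_of_under_eq hw hv2) ((hψunr w).mp (hψv w hw))
  -- unramifiedness of `Ind θ`, hence of `ρ`, hence of the Tate twist
  have hunrρ : ρ.IsUnramifiedAt v :=
    (isUnramifiedAt_iff_of_forall_eq_conj hP v).mp
      (θ.isUnramifiedAt_induce ℚ hK2 hI fun w hw => (hgoodv w hw).1)
  refine ⟨fun 𝔓 h𝔓 σ hσ => ?_, fun 𝔓 h𝔓 σ hσ => ?_⟩
  · have hε : χm σ = 1 := by
      rw [hχm, cyclotomicPadicAlgCl_eq_one_of_mem_inertia 2 hv2 h𝔓 hσ, one_zpow]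
    rw [FramedRep.twist_apply_of_eq_one ρ _ hε]
    exact hunrρ 𝔓 h𝔓 σ hσ
  · -- Frobenius polynomials: Tate twist of the induced polynomial of `θ` = Hecke polynomial of `f`
    have hind := θ.hasFrobCharpolyAt_induce ℚ hK2 hI (fun w hw => (hgoodv w hw).2) 𝔓 h𝔓 σ hσ
    have hρσ : FramedRep.charpoly ρ σ =
        inducedFrobPolynomial v fun w => X - C (ι.symm (χ.valueAtUniformizer w)⁻¹) :=
      (hθ σ).trans hind
    have hcardv : v.residueCard = pv := by rw [hpv, Rat.residueCard_eq_natGenerator]; rfl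
    have hεσ : ((χm σ : (PadicAlgCl 2)ˣ) : PadicAlgCl 2) = (pv : PadicAlgCl 2) ^ m := by
      rw [hχm, Units.val_zpow_eq_zpow_val,
        coe_cyclotomicPadicAlgCl_of_isArithFrobAt 2 hv2 h𝔓 hσ, hcardv]
    change FramedRep.charpoly (FramedRep.twist ρ χm) σ = _
    rw [charpoly_twist_eq_scaleRoots, hρσ, hεσ, scaleRoots_inducedFrobPolynomial,
      ← Polynomial.map_map, hpoly, map_inducedFrobPolynomial]
    refine inducedFrobPolynomial_congr v fun w hw => ?_
    have key : ((pv : PadicAlgCl 2) ^ m) ^ w.asIdeal.inertiaDeg (𝓞 ℚ) =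
        ((w.residueCard : ℕ) : PadicAlgCl 2) ^ m := by
      rw [residueCard_eq_pow_inertiaDeg_of_under_eq hw, hcardv, Nat.cast_pow, ← zpow_natCast,
        ← zpow_mul, ← zpow_natCast (pv : PadicAlgCl 2), ← zpow_mul, mul_comm]
    rw [hψval w]
    change X - C (((pv : PadicAlgCl 2) ^ m) ^ w.asIdeal.inertiaDeg (𝓞 ℚ) *
        ι.symm (χ.valueAtUniformizer w)⁻¹) =
      X - C (ι.symm ((χ.valueAtUniformizer w)⁻¹ * (w.residueCard : ℂ) ^ m))
    rw [map_mul ι.symm, map_zpow₀ ι.symm, map_natCast, key]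
    congr 2
    exact mul_comm _ _

end Summit.Langlands.Langlands.Theorems.DyadicEisensteinFM

end
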